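import Mathlib
import Summits.ValiantsHypothesis.ValiantsHypothesis.Theorems.BarrierLeverPartitionMinorsHitByVPMatchedPairsDropOut
import Summits.ValiantsHypothesis.ValiantsHypothesis.Theses.BarrierLever

/-!
# Route BarrierLever — item `PartitionMinorsHitByVP` (stmt-ValiantsHypothesis-19717):
# matched pairs drop out — assembled to the route declaration

Helper file (`--supports stmt-ValiantsHypothesis-19717`; cell valiant-natproofs, rung V4, 𝒟-side,
prover seat val-np-p3 gen 2). Definition-free. Closes NO item.

* **`partitionMinorsHitByVP_of_commonFreeLayouts`** — item `PartitionMinorsHitByVP` VERBATIM follows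
  from its restriction to COMMON-FREE layouts (`u i ≠ w j` for all `i, j`): the common members are
  absorbed by the diagonal state `∏ (1 + x_a y_a)` and a one-parameter perturbation
  (`…MatchedPairs.partitionMinorsHitByVP_of_commonFree`).

WHAT THIS IS NOT: the common-free residue is OPEN; nothing on crux 14610 / VP vs VNP.
-/

set_option linter.dupNamespace false

namespace Summit.ValiantsHypothesis.ValiantsHypothesis.Theorems.BarrierLever.MatchedPairs

open Literature.Barriers.ValiantsHypothesis

/-- **Item `PartitionMinorsHitByVP` reduces to common-free layouts** (route declaration verbatim). -/
theorem partitionMinorsHitByVP_of_commonFreeLayouts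
    (hcf : ∃ b h₀ : ℕ, ∀ h : ℕ, h₀ ≤ h → ∀ (r : ℕ) (u w : Fin r → Finset (Fin h)),
      Function.Injective u → Function.Injective w → (∀ i j, u i ≠ w j) →
      ∃ f ∈ SmallCircuits ℂ (h + h) b,
        (Matrix.of fun i j : Fin r => MvPolynomial.coeff
          (∑ a ∈ u i, Finsupp.single (Fin.castAdd h a) 1 +
            ∑ c ∈ w j, Finsupp.single (Fin.natAdd h c) 1) f).det ≠ 0) :
    Summit.ValiantsHypothesis.ValiantsHypothesis.Theses.BarrierLever.PartitionMinorsHitByVP := by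
  obtain ⟨b, h₀, H⟩ := partitionMinorsHitByVP_of_commonFree hcf
  exact ⟨b, h₀, fun h hh r u w hu hw => H h hh r u w hu hw⟩

end Summit.ValiantsHypothesis.ValiantsHypothesis.Theorems.BarrierLever.MatchedPairs
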